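import Mathlib
import Summits.Ventures.PercRepro.TriangleCapThreeBelowDiagonalTen
import Summits.Ventures.PercRepro.TriangleCapThreeBelowTwoTrianglesNine
import Summits.Ventures.PercRepro.TriangleCapThreeBelowThreeTrianglesNineC
import Summits.Ventures.PercRepro.TriangleCapThreeBelowFourTrianglesNine
import Summits.Ventures.PercRepro.TriangleCapThreeBelowPendant

/-!
# PercRepro — THREE BELOW THE DIAGONAL IS EXACT ON THE `K₄⁻`-FREE CLASS FOR EVERY `k ≥ 9` — THE CELL `(9, 15)`
(p3, gen 38; part 119)

**`dense_stability_three_nine_fifteen`**: a `K₄⁻`-free graph on `9` vertices with `15` edges that is not bipartite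
spanning with at most two missing cross pairs has `Σ_v d(v)² + 15 ≤ 135`: a vertex of degree `≤ 1` by the
pendant / isolated reductions (part 113); otherwise by the number of triangles — none (gen 36), one (the outer
vertices, gen 37, and the private graph, parts 104–105), two (vertex-disjoint: part 98, tight on the prism family;
sharing a vertex: part 115), three (parts 116–118), four (part 114), five or more (the envelope).
**`cell_nine_fifteen_k4m`**: `2·Σ_v C(d(v), 2) ≤ 90`, attained by `K_{3,6}` minus three edges at a vertex — the first
cell of the sub-diagonal `r = 3`, tight with triangles.  **`three_below_diagonal_exact_k4m_of_nine`**: for every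
`k ≥ 9`, `m = a (k − a) − 3 ≥ 2k − 3` with `m, m + 1, m + 2` not products `a′ (k − a′)`, the maximum of
`2·Σ_v C(d(v), 2)` over the `K₄⁻`-free graphs on `Fin k` with `m` edges IS `m (k − 2) − 3 (k − 4)` — the whole
sub-diagonal `r = 3` of the closed form on the dense corner (at `k = 9` the only cell is `(9, 15)`: `a ∈ {3, 6}`;
`a = 4, 5` give `m = 17` with `18 = 3·6`).  Axioms: standard.
-/

namespace PercRepro

namespace TriangleCap

namespace C047

open Finset

variable {V : Type*} [Fintype V] [DecidableEq V]

/-- **THE `r = 3` STABILITY AT `(9, 15)`.** -/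
theorem dense_stability_three_nine_fifteen (D : SimpleGraph V) [DecidableRel D.Adj] (hK : K4mFree D)
    (hk : Fintype.card V = 9) (hm : D.edgeFinset.card = 15)
    (hnot : ¬ ∃ A : Finset V, (∀ x y, D.Adj x y → (x ∈ A ↔ y ∉ A)) ∧ (missing D A Aᶜ).card ≤ 2) :
    ∑ v, deg D v * deg D v + 3 * (Fintype.card V - 4) ≤ D.edgeFinset.card * Fintype.card V := by
  have hm' : 6 * Fintype.card V ≤ 2 * D.edgeFinset.card + 24 := by omega
  have hk9 : 9 ≤ Fintype.card V := by omega
  have hm2 : 2 * Fintype.card V ≤ D.edgeFinset.card + 3 := by omega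
  by_cases hlow : ∃ v, deg D v ≤ 1
  · obtain ⟨v, hv⟩ := hlow
    rcases Nat.eq_zero_or_pos (deg D v) with h0 | h1
    · exact stability_three_of_isolated D hK hk9 hm' (z := v) h0
    · exact stability_three_of_pendant D hK hk9 hm' hnot (z := v) (by omega)
  push Not at hlow
  by_cases hfree : D.CliqueFree 3
  · exact triangle_free_stability_three D hfree hm2 hnot
  obtain ⟨S, hS⟩ := not_forall.mp hfree
  have hS' := not_not.mp hS
  rw [SimpleGraph.is3Clique_iff] at hS'
  obtain ⟨u, v, w, huv, huw, hvw, -⟩ := hS'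
  by_cases hT : ∀ a b c, D.Adj a b → D.Adj a c → D.Adj b c → a = u ∨ a = v ∨ a = w
  · -- ONE TRIANGLE
    set Q : Finset V := (({u, v, w} : Finset V)ᶜ).filter (fun z => degIn D {u, v, w} z = 0) with hQ
    rcases Nat.lt_or_ge Q.card 2 with hQ2 | hQ2
    · rcases Nat.eq_zero_or_pos Q.card with hQ0 | hQ1
      · have hq : ∀ z, z ∉ ({u, v, w} : Finset V) → 1 ≤ degIn D {u, v, w} z := by
          intro z hz
          by_contra h0
          have hzQ : z ∈ Q := by
            rw [hQ, mem_filter, mem_compl]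
            exact ⟨hz, by omega⟩
          rw [card_eq_zero] at hQ0
          rw [hQ0] at hzQ
          exact notMem_empty z hzQ
        exact one_triangle_stability_three_no_outer D hK huv huw hvw hT hq hk9 hm' (by omega) (Or.inr (by omega))
      · have hQ1' : Q.card = 1 := by omega
        obtain ⟨z, hz⟩ := card_eq_one.mp hQ1'
        have hzQ : z ∈ Q := by rw [hz]; exact mem_singleton_self z
        rw [hQ, mem_filter, mem_compl] at hzQ
        have hq : ∀ y, y ∉ ({u, v, w} : Finset V) → y ≠ z → 1 ≤ degIn D {u, v, w} y := by
          intro y hy hyz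
          by_contra h0
          have hyQ : y ∈ Q := by
            rw [hQ, mem_filter, mem_compl]
            exact ⟨hy, by omega⟩
          rw [hz, mem_singleton] at hyQ
          exact hyz hyQ
        exact one_triangle_stability_three_of_one_outer D hK huv huw hvw hT hzQ.1 hzQ.2 hq (by omega)
    · exact one_triangle_stability_three_of_outer D hK huv huw hvw hT hm' (by rw [← hQ]; omega)
  simp only [not_forall, not_or] at hT
  obtain ⟨a, b, c, hab, hac, hbc, hau, hav, haw⟩ := hT
  have ha : ¬ (a = u ∨ a = v ∨ a = w) := fun h => by
    rcases h with h | h | h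
    · exact hau h
    · exact hav h
    · exact haw h
  by_cases hT3 : ∀ x y z, D.Adj x y → D.Adj x z → D.Adj y z → x = u ∨ x = v ∨ x = w ∨ x = a ∨ x = b ∨ x = c
  · -- TWO TRIANGLES
    by_cases hdisj : ∀ t, (t = u ∨ t = v ∨ t = w) → ¬ (t = a ∨ t = b ∨ t = c)
    · exact two_triangles_stability_three_of_disjoint D hK hk9 hm' huv huw hvw hab hac hbc hT3 hdisj
    · simp only [not_forall, not_not, exists_prop] at hdisj
      obtain ⟨t, ht1, ht2⟩ := hdisj
      exact two_triangles_stability_three_of_shared_nine D hK hk9 hm' (fun v => by have := hlow v; omega)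
        huv huw hvw hab hac hbc ha hT3 ⟨ht1, ht2⟩
  simp only [not_forall, not_or] at hT3
  obtain ⟨x, y, z, hxy, hxz, hyz, hxu, hxv, hxw, hxa, hxb, hxc⟩ := hT3
  have hx : ¬ (x = u ∨ x = v ∨ x = w ∨ x = a ∨ x = b ∨ x = c) := fun h => by
    rcases h with h | h | h | h | h | h
    · exact hxu h
    · exact hxv h
    · exact hxw h
    · exact hxa h
    · exact hxb h
    · exact hxc h
  set T₁ : Finset V := {u, v, w} with hT₁
  set T₂ : Finset V := {a, b, c} with hT₂
  set T₃ : Finset V := {x, y, z} with hT₃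
  by_cases hT4 : ∀ x' y' z', D.Adj x' y' → D.Adj x' z' → D.Adj y' z' →
      (x' ∈ T₁ ∧ y' ∈ T₁) ∨ (x' ∈ T₂ ∧ y' ∈ T₂) ∨ (x' ∈ T₃ ∧ y' ∈ T₃)
  · -- THREE TRIANGLES
    exact three_triangles_stability_three_nine D hK hk hm huv huw hvw hab hac hbc hxy hxz hyz ha hx hT4
  have h₁ : T₁.card = 3 := card_triple huv.ne huw.ne hvw.ne
  have h₂ : T₂.card = 3 := card_triple hab.ne hac.ne hbc.ne
  have h₃ : T₃.card = 3 := card_triple hxy.ne hxz.ne hyz.ne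
  have hcl₁ := clique_triple D huv huw hvw
  have hcl₂ := clique_triple D hab hac hbc
  have hcl₃ := clique_triple D hxy hxz hyz
  have hx1 : ¬ (x = u ∨ x = v ∨ x = w) := fun h => hx (by tauto)
  have hx2 : ¬ (x = a ∨ x = b ∨ x = c) := fun h => hx (by tauto)
  have hi12 : (T₁ ∩ T₂).card ≤ 1 := inter_card_le_one_of_triangles D hK huv huw hvw hab hac hbc ha
  have hi13 : (T₁ ∩ T₃).card ≤ 1 := inter_card_le_one_of_triangles D hK huv huw hvw hxy hxz hyz hx1
  have hi23 : (T₂ ∩ T₃).card ≤ 1 := inter_card_le_one_of_triangles D hK hab hac hbc hxy hxz hyz hx2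
  simp only [not_forall, not_or] at hT4
  obtain ⟨x', y', z', hxy', hxz', hyz', h1, h2, h3⟩ := hT4
  set T₄ : Finset V := {x', y', z'} with hT₄
  have h₄ : T₄.card = 3 := card_triple hxy'.ne hxz'.ne hyz'.ne
  have hcl₄ := clique_triple D hxy' hxz' hyz'
  have hx'4 : x' ∈ T₄ := by rw [hT₄]; exact mem_insert_self _ _
  have hy'4 : y' ∈ T₄ := by rw [hT₄]; exact mem_insert_of_mem (mem_insert_self _ _)
  have hne1 : T₄ ≠ T₁ := fun h => h1 ⟨h ▸ hx'4, h ▸ hy'4⟩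
  have hne2 : T₄ ≠ T₂ := fun h => h2 ⟨h ▸ hx'4, h ▸ hy'4⟩
  have hne3 : T₄ ≠ T₃ := fun h => h3 ⟨h ▸ hx'4, h ▸ hy'4⟩
  have hne12 : T₁ ≠ T₂ := fun h => by rw [h, inter_self, h₂] at hi12; omega
  have hne13 : T₁ ≠ T₃ := fun h => by rw [h, inter_self, h₃] at hi13; omega
  have hne23 : T₂ ≠ T₃ := fun h => by rw [h, inter_self, h₃] at hi23; omega
  by_cases hT5 : ∀ x'' y'' z'', D.Adj x'' y'' → D.Adj x'' z'' → D.Adj y'' z'' →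
      (x'' ∈ T₁ ∧ y'' ∈ T₁) ∨ (x'' ∈ T₂ ∧ y'' ∈ T₂) ∨ (x'' ∈ T₃ ∧ y'' ∈ T₃) ∨ (x'' ∈ T₄ ∧ y'' ∈ T₄)
  · -- FOUR TRIANGLES
    exact four_triangles_stability_three_nine D hK hk hm T₁ T₂ T₃ T₄ h₁ h₂ h₃ h₄ hcl₁ hcl₂ hcl₃ hcl₄ hne12
      hne13 (Ne.symm hne1) hne23 (Ne.symm hne2) (Ne.symm hne3) hT5
  -- FIVE OR MORE
  simp only [not_forall, not_or] at hT5
  obtain ⟨x'', y'', z'', hxy'', hxz'', hyz'', g1, g2, g3, g4⟩ := hT5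
  set T₅ : Finset V := {x'', y'', z''} with hT₅
  have hx''5 : x'' ∈ T₅ := by rw [hT₅]; exact mem_insert_self _ _
  have hy''5 : y'' ∈ T₅ := by rw [hT₅]; exact mem_insert_of_mem (mem_insert_self _ _)
  have hne51 : T₅ ≠ T₁ := fun h => g1 ⟨h ▸ hx''5, h ▸ hy''5⟩
  have hne52 : T₅ ≠ T₂ := fun h => g2 ⟨h ▸ hx''5, h ▸ hy''5⟩
  have hne53 : T₅ ≠ T₃ := fun h => g3 ⟨h ▸ hx''5, h ▸ hy''5⟩
  have hne54 : T₅ ≠ T₄ := fun h => g4 ⟨h ▸ hx''5, h ▸ hy''5⟩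
  have hF : ({T₁, T₂, T₃, T₄, T₅} : Finset (Finset V)).card = 5 := by
    rw [card_insert_of_notMem, card_insert_of_notMem, card_insert_of_notMem, card_insert_of_notMem,
      card_singleton]
    · rw [mem_singleton]; exact Ne.symm hne54
    · rw [mem_insert, mem_singleton, not_or]; exact ⟨Ne.symm hne3, Ne.symm hne53⟩
    · rw [mem_insert, mem_insert, mem_singleton, not_or, not_or]; exact ⟨hne23, Ne.symm hne2, Ne.symm hne52⟩
    · rw [mem_insert, mem_insert, mem_insert, mem_singleton, not_or, not_or, not_or]
      exact ⟨hne12, hne13, Ne.symm hne1, Ne.symm hne51⟩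
  have h30 := six_mul_card_le_card_triangles3 D {T₁, T₂, T₃, T₄, T₅} (by
    intro T hT'
    simp only [mem_insert, mem_singleton] at hT'
    rcases hT' with rfl | rfl | rfl | rfl | rfl
    · exact ⟨u, v, w, huv, huw, hvw, rfl⟩
    · exact ⟨a, b, c, hab, hac, hbc, rfl⟩
    · exact ⟨x, y, z, hxy, hxz, hyz, rfl⟩
    · exact ⟨x', y', z', hxy', hxz', hyz', rfl⟩
    · exact ⟨x'', y'', z'', hxy'', hxz'', hyz'', rfl⟩)
  rw [hF] at h30
  have h := stability_of_triangles D hK (by omega) 5 3 (by omega) (by omega)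
  have e : Fintype.card V - 3 - 1 = Fintype.card V - 4 := by omega
  rw [e] at h
  exact h

/-- The cell `(9, 15)` on `K₄⁻`-free graphs (`15 = 3·6 − 3`; `15, 16, 17` are not products `a′(9 − a′)`):
`2·cherries ≤ 90`, attained (by `K_{3,6}` minus three edges at a vertex). -/
theorem cell_nine_fifteen_k4m :
    (∀ (D : SimpleGraph (Fin 9)) [DecidableRel D.Adj], K4mFree D → D.edgeFinset.card = 15 →
      2 * cherries D ≤ 90) ∧
    ∃ (D : SimpleGraph (Fin 9)) (_ : DecidableRel D.Adj), K4mFree D ∧ D.edgeFinset.card = 15 ∧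
      2 * cherries D = 90 := by
  constructor
  · intro D _ hK hD
    have hcard : Fintype.card (Fin 9) = 9 := Fintype.card_fin 9
    have hnot : ¬ ∃ A : Finset (Fin 9), (∀ x y, D.Adj x y → (x ∈ A ↔ y ∉ A)) ∧ (missing D A Aᶜ).card ≤ 2 := by
      rintro ⟨A, hA, hN⟩
      have hNX := card_missing_add_card_edges D A hA
      have hXc : Aᶜ.card = 9 - A.card := by
        have := card_add_card_compl A
        rw [hcard] at this
        omega
      have hXk : A.card ≤ 9 := by
        have := card_le_univ A
        rwa [hcard] at this
      rw [hXc, hD] at hNX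
      have hprod : ∀ a', a' ≤ 9 → 15 ≠ a' * (9 - a') ∧ 16 ≠ a' * (9 - a') ∧ 17 ≠ a' * (9 - a') := by decide
      obtain ⟨h1, h2, h3⟩ := hprod A.card hXk
      have : (missing D A Aᶜ).card = 0 ∨ (missing D A Aᶜ).card = 1 ∨ (missing D A Aᶜ).card = 2 := by omega
      rcases this with h | h | h
      · rw [h] at hNX; exact h1 (by omega)
      · rw [h] at hNX; exact h2 (by omega)
      · rw [h] at hNX; exact h3 (by omega)
    have h1 := dense_stability_three_nine_fifteen D hK hcard hD hnot
    have h2 := two_mul_cherries_add D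
    have h3 := sum_deg_eq D
    rw [hcard, hD] at h1
    rw [hD] at h3
    omega
  · refine ⟨bipMinusStar 9 3 3, inferInstance, k4mFree_bipMinusStar 9 3 3, ?_, ?_⟩
    · have := card_edges_bipMinusStar 9 3 3 (by norm_num) (by norm_num)
      omega
    · have h := two_mul_cherries_bipMinusStar 9 3 3 (by norm_num) (by norm_num) (by norm_num)
      norm_num at h
      omega

/-- **THREE BELOW THE DIAGONAL IS EXACT ON THE `K₄⁻`-FREE CLASS FOR EVERY `k ≥ 9`** — the whole sub-diagonal `r = 3`
of the dense corner. -/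
theorem three_below_diagonal_exact_k4m_of_nine (k a : ℕ) (hk : 9 ≤ k) (ha : 1 ≤ a) (hak : a + 3 ≤ k)
    (hdense : 2 * k ≤ a * (k - a) - 3 + 3)
    (hm : ∀ a', a' ≤ k → a * (k - a) - 3 ≠ a' * (k - a') ∧ a * (k - a) - 2 ≠ a' * (k - a') ∧
      a * (k - a) - 1 ≠ a' * (k - a')) :
    (∀ (D : SimpleGraph (Fin k)) [DecidableRel D.Adj], K4mFree D →
        D.edgeFinset.card = a * (k - a) - 3 →
        2 * cherries D + 3 * (k - 4) ≤ (a * (k - a) - 3) * (k - 2)) ∧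
      ∃ (D : SimpleGraph (Fin k)) (_ : DecidableRel D.Adj), K4mFree D ∧
        D.edgeFinset.card = a * (k - a) - 3 ∧ 2 * cherries D + 3 * (k - 4) = (a * (k - a) - 3) * (k - 2) := by
  rcases Nat.lt_or_ge k 10 with hk9 | hk10
  · have hk' : k = 9 := by omega
    subst hk'
    have ha6 : a ≤ 6 := by omega
    interval_cases a
    · norm_num at hdense
    · norm_num at hdense
    · have h := cell_nine_fifteen_k4m
      norm_num
      obtain ⟨h1, D, inst, h2, h3, h4⟩ := h
      exact ⟨fun D _ hK hD => by have := h1 D hK hD; omega, D, inst, h2, h3, by omega⟩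
    · exact absurd (by norm_num) (hm 3 (by norm_num)).2.1
    · exact absurd (by norm_num) (hm 3 (by norm_num)).2.1
    · have h := cell_nine_fifteen_k4m
      norm_num
      obtain ⟨h1, D, inst, h2, h3, h4⟩ := h
      exact ⟨fun D _ hK hD => by have := h1 D hK hD; omega, D, inst, h2, h3, by omega⟩
  · exact three_below_diagonal_exact_k4m_of_ten k a hk10 ha hak hdense hm

end C047

end TriangleCap

end PercRepro
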